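import Literature.MathematicalPhysics.QuantumManyBody.PeriodicBoseGasFourier
import Literature.MathematicalPhysics.QuantumManyBody.PeriodicBoseGasLemma33
import Mathlib.Analysis.Calculus.BumpFunction.Normed
import Mathlib.Analysis.Calculus.BumpFunction.InnerProduct
import Mathlib.Analysis.Calculus.LineDeriv.IntegrationByParts
import Mathlib.MeasureTheory.Measure.Haar.NormedSpace
import HarnessLib

/-!
# Route `BECConjugateDomination`, glue `IMUChainGlue` (stmt-AtomisticToContinuum-11790) —
# helper: the scaled bump and its plane-wave integrals

A fixed smooth profile `χ ≥ 0` on `ℝ³` with `∫χ = 1` and `supp χ ⊆ B(0,2)` (a normalised Mathlib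
`ContDiffBump`), its rescaling `η_a(x) = a⁻³ χ(x/a)` (`∫η_a = 1`, `supp η_a ⊆ B(0,2a)`,
`∫η_a² = a⁻³∫χ²`, `∫|∂ⱼη_a|² = a⁻⁵∫|∂ⱼχ|²`), and the plane-wave integrals
`E_n = ∫_{ℝ³} conj(e_n) η_a` (`e_n(x) = e^{2πi n·x/L}`): `|E_n| ≤ 1`, `E_0 = 1`, and the
integration-by-parts identity `(2πi nⱼ/L) E_n = ∫ conj(e_n) ∂ⱼη_a`.  These feed the kernel of the
Jensen–Parseval bookkeeping of `IMUChainGlue`.  (The profile and the bump are local notations, not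
definitions: `χ`, `ηv⟦a, x⟧ = a⁻³ χ(a⁻¹x)` and `ηf⟦a⟧ = fun x ↦ ηv⟦a, x⟧`.)
-/

noncomputable section

open MeasureTheory Set Complex
open scoped ENNReal NNReal Topology ComplexConjugate

namespace Summit.AtomisticToContinuum.BoseEinsteinCondensation.Theorems.IMUChainGlue

open Literature.MathematicalPhysics.QuantumManyBody.BoseGas

/-! ### The fixed profile -/

/-- The profile: Mathlib's bump with radii `1 < 2` centred at the origin of `ℝ³`, normalised to
integral one (local notation). -/
local notation "χ" => (ContDiffBump.normed
  (ContDiffBump.mk 1 2 one_pos one_lt_two : ContDiffBump (0 : Space)) volume)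

/-- The scaled bump, value form: `ηv⟦a, x⟧ = a⁻³ χ(a⁻¹ x)` (local notation). -/
local notation "ηv⟦" a ", " x "⟧" => (a ^ 3)⁻¹ * χ (a⁻¹ • x)

/-- The scaled bump, function form: `ηf⟦a⟧ = fun x ↦ a⁻³ χ(a⁻¹ x)` (local notation). -/
local notation "ηf⟦" a "⟧" => fun x : Space => (a ^ 3)⁻¹ * χ (a⁻¹ • x)

/-- `χ ≥ 0`. -/
theorem profile_nonneg (x : Space) : 0 ≤ χ x := ContDiffBump.nonneg_normed _ _

/-- `χ` is smooth. -/
theorem contDiff_profile {n : ℕ∞} : ContDiff ℝ n χ := ContDiffBump.contDiff_normed _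

/-- `∫ χ = 1`. -/
theorem integral_profile : ∫ x : Space, χ x = 1 := ContDiffBump.integral_normed _

/-- `χ` vanishes outside the ball of radius `2`. -/
theorem profile_eq_zero {x : Space} (hx : 2 ≤ ‖x‖) : χ x = 0 := by
  have h : x ∉ Function.support χ := by
    rw [ContDiffBump.support_normed_eq]
    simpa using hx
  simpa [Function.mem_support] using h

/-! ### The scaled bump `η_a(x) = a⁻³ χ(x/a)` -/

/-- `η_a ≥ 0` for `a > 0`. -/
theorem bump_nonneg {a : ℝ} (ha : 0 < a) (x : Space) : 0 ≤ ηv⟦a, x⟧ :=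
  mul_nonneg (by positivity) (profile_nonneg _)

/-- `η_a` is `C^∞`. -/
theorem contDiff_bump (a : ℝ) {n : ℕ∞} : ContDiff ℝ n ηf⟦a⟧ :=
  contDiff_const.mul (contDiff_profile.comp (contDiff_const_smul _))

/-- `η_a` is continuous. -/
theorem continuous_bump (a : ℝ) : Continuous ηf⟦a⟧ :=
  (contDiff_bump a (n := 0)).continuous

/-- `η_a` vanishes outside the ball of radius `2a`. -/
theorem bump_eq_zero {a : ℝ} (ha : 0 < a) {x : Space} (hx : 2 * a ≤ ‖x‖) : ηv⟦a, x⟧ = 0 := by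
  have h : 2 ≤ ‖a⁻¹ • x‖ := by
    rw [norm_smul, norm_inv, Real.norm_of_nonneg ha.le, inv_mul_eq_div, le_div_iff₀ ha]
    exact hx
  rw [profile_eq_zero h, mul_zero]

/-- `η_a` has compact support (it vanishes off the closed ball of radius `2a`). -/
theorem hasCompactSupport_bump {a : ℝ} (ha : 0 < a) : HasCompactSupport ηf⟦a⟧ := by
  refine HasCompactSupport.of_support_subset_isCompact (isCompact_closedBall (0 : Space) (2 * a)) ?_
  intro x hx
  rw [Metric.mem_closedBall, dist_zero_right]
  by_contra h
  exact hx (bump_eq_zero ha (not_le.1 h).le)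

/-- Squares of compactly supported real functions are compactly supported. -/
theorem hasCompactSupport_sq {f : Space → ℝ} (hf : HasCompactSupport f) :
    HasCompactSupport fun x => f x ^ 2 := by
  rw [show (fun x => f x ^ 2) = f * f from funext fun x => by simp [sq]]
  exact hf.mul_right

/-- `η_a²` is integrable. -/
theorem integrable_bump_sq {a : ℝ} (ha : 0 < a) : Integrable fun x => ηv⟦a, x⟧ ^ 2 :=
  ((continuous_bump a).pow 2).integrable_of_hasCompactSupport
    (hasCompactSupport_sq (hasCompactSupport_bump ha))

/-- Scaling of integrals on `ℝ³`: `∫ G(a⁻¹x) dx = a³ ∫ G`. -/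
theorem integral_comp_inv_smul {E : Type*} [NormedAddCommGroup E] [NormedSpace ℝ E] {a : ℝ}
    (ha : 0 < a) (G : Space → E) : ∫ x : Space, G (a⁻¹ • x) = a ^ 3 • ∫ x, G x := by
  rw [Measure.integral_comp_inv_smul_of_nonneg volume G ha.le, finrank_euclideanSpace_fin]

/-- `∫ η_a = 1`. -/
theorem integral_bump {a : ℝ} (ha : 0 < a) : ∫ x, ηv⟦a, x⟧ = 1 := by
  rw [integral_const_mul, integral_comp_inv_smul ha χ, integral_profile, smul_eq_mul, mul_one,
    inv_mul_cancel₀ (by positivity)]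

/-- `∫ η_a² = a⁻³ ∫ χ²`. -/
theorem integral_bump_sq {a : ℝ} (ha : 0 < a) :
    ∫ x, ηv⟦a, x⟧ ^ 2 = (a ^ 3)⁻¹ * ∫ y : Space, (χ y) ^ 2 := by
  have h : ∀ x : Space, ηv⟦a, x⟧ ^ 2 = (a ^ 3)⁻¹ ^ 2 * (fun y : Space => (χ y) ^ 2) (a⁻¹ • x) := by
    intro x; simp only; ring
  simp_rw [h]
  rw [integral_const_mul, integral_comp_inv_smul ha (fun y : Space => (χ y) ^ 2), smul_eq_mul]
  field_simp

/-- The derivative of the scaled bump: `∂_w η_a(x) = a⁻⁴ (∂_w χ)(a⁻¹x)`. -/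
theorem fderiv_bump (a : ℝ) (x w : Space) :
    fderiv ℝ ηf⟦a⟧ x w = (a ^ 3)⁻¹ * (a⁻¹ * fderiv ℝ χ (a⁻¹ • x) w) := by
  have hd : DifferentiableAt ℝ (fun y : Space => χ (a⁻¹ • y)) x :=
    (((contDiff_profile (n := 1)).comp (contDiff_const_smul a⁻¹)).differentiable one_ne_zero) x
  have h1 : fderiv ℝ ηf⟦a⟧ x = (a ^ 3)⁻¹ • fderiv ℝ (fun y : Space => χ (a⁻¹ • y)) x :=
    fderiv_const_mul hd _
  rw [h1, FunLike.coe_smul, Pi.smul_apply, fderiv_comp_smul a⁻¹, FunLike.coe_smul, Pi.smul_apply,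
    smul_eq_mul, smul_eq_mul]

/-- `∫ |∂ⱼη_a|² = a⁻⁵ ∫ |∂ⱼχ|²`. -/
theorem integral_fderiv_bump_sq {a : ℝ} (ha : 0 < a) (w : Space) :
    ∫ x, (fderiv ℝ ηf⟦a⟧ x w) ^ 2 = (a ^ 5)⁻¹ * ∫ y : Space, (fderiv ℝ χ y w) ^ 2 := by
  have h : ∀ x : Space, (fderiv ℝ ηf⟦a⟧ x w) ^ 2 =
      ((a ^ 3)⁻¹ * a⁻¹) ^ 2 * (fun y : Space => (fderiv ℝ χ y w) ^ 2) (a⁻¹ • x) := by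
    intro x; rw [fderiv_bump a]; ring
  simp_rw [h]
  rw [integral_const_mul, integral_comp_inv_smul ha (fun y : Space => (fderiv ℝ χ y w) ^ 2),
    smul_eq_mul]
  field_simp

/-- The partial derivatives of `η_a` are continuous. -/
theorem continuous_fderiv_bump (a : ℝ) (w : Space) : Continuous fun x => fderiv ℝ ηf⟦a⟧ x w :=
  ((contDiff_bump a (n := 1)).continuous_fderiv one_ne_zero).clm_apply continuous_const

/-- The partial derivatives of `η_a` have compact support. -/
theorem hasCompactSupport_fderiv_bump {a : ℝ} (ha : 0 < a) (w : Space) :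
    HasCompactSupport fun x => fderiv ℝ ηf⟦a⟧ x w :=
  (hasCompactSupport_bump ha).fderiv_apply (𝕜 := ℝ) w

/-- `|∂_wη_a|²` is integrable. -/
theorem integrable_fderiv_bump_sq {a : ℝ} (ha : 0 < a) (w : Space) :
    Integrable fun x => (fderiv ℝ ηf⟦a⟧ x w) ^ 2 :=
  ((continuous_fderiv_bump a w).pow 2).integrable_of_hasCompactSupport
    (hasCompactSupport_sq (hasCompactSupport_fderiv_bump ha w))

/-- The topological support of `η_a` lies in the closed ball of radius `2a`. -/
theorem tsupport_bump_subset {a : ℝ} (ha : 0 < a) :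
    tsupport ηf⟦a⟧ ⊆ Metric.closedBall (0 : Space) (2 * a) := by
  refine closure_minimal (fun x hx => ?_) Metric.isClosed_closedBall
  rw [Metric.mem_closedBall, dist_zero_right]
  by_contra h
  exact hx (bump_eq_zero ha (not_le.1 h).le)

/-- The partial derivatives of `η_a` vanish outside the ball of radius `3a`. -/
theorem fderiv_bump_eq_zero {a : ℝ} (ha : 0 < a) {x : Space} (hx : 3 * a ≤ ‖x‖) (w : Space) :
    fderiv ℝ ηf⟦a⟧ x w = 0 := by
  have hx' : x ∉ tsupport ηf⟦a⟧ := fun h => by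
    have h2 := tsupport_bump_subset ha h
    rw [Metric.mem_closedBall, dist_zero_right] at h2
    linarith
  have h0 : fderiv ℝ ηf⟦a⟧ x = 0 := by
    by_contra hne
    exact hx' (support_fderiv_subset ℝ (Function.mem_support.2 hne))
  rw [h0]; rfl

/-! ### Plane-wave integrals of the bump -/

/-- `e_n` is differentiable. -/
theorem differentiable_cellWave (L : ℝ) (n : Fin 3 → ℤ) : Differentiable ℝ (cellWave L n) :=
  (contDiff_cellWave L n).differentiable (by simp)

/-- **`|E_n| ≤ 1`**: `‖∫ conj(e_n) η_a‖ ≤ ∫ η_a = 1`. -/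
theorem norm_integral_conj_cellWave_mul_bump_le {a : ℝ} (ha : 0 < a) (L : ℝ) (n : Fin 3 → ℤ) :
    ‖∫ x, conj (cellWave L n x) * ((ηv⟦a, x⟧ : ℝ) : ℂ)‖ ≤ 1 := by
  refine (norm_integral_le_integral_norm _).trans (le_of_eq ?_)
  calc ∫ x, ‖conj (cellWave L n x) * ((ηv⟦a, x⟧ : ℝ) : ℂ)‖ = ∫ x, ηv⟦a, x⟧ := by
        refine integral_congr_ae (Filter.Eventually.of_forall fun x => ?_)
        simp only [norm_mul, Complex.norm_conj, norm_cellWave, one_mul, Complex.norm_real,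
          Real.norm_of_nonneg (bump_nonneg ha x)]
    _ = 1 := integral_bump ha

/-- **`E_0 = 1`**. -/
theorem integral_conj_cellWave_zero_mul_bump {a : ℝ} (ha : 0 < a) (L : ℝ) :
    ∫ x, conj (cellWave L 0 x) * ((ηv⟦a, x⟧ : ℝ) : ℂ) = 1 := by
  simp only [cellWave_zero, map_one, one_mul]
  rw [integral_complex_ofReal, integral_bump ha, Complex.ofReal_one]

/-- **Integration by parts against a plane wave**:
`∫ conj(e_n) ∂ⱼη_a = (2πi nⱼ/L) ∫ conj(e_n) η_a`. -/
theorem integral_conj_cellWave_mul_fderiv_bump {a : ℝ} (ha : 0 < a) (L : ℝ) (n : Fin 3 → ℤ)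
    (j : Fin 3) :
    ∫ x, conj (cellWave L n x) * (fderiv ℝ ηf⟦a⟧ x (EuclideanSpace.single j 1) : ℂ) =
      (2 * Real.pi * Complex.I * (n j) / L) * ∫ x, conj (cellWave L n x) * ((ηv⟦a, x⟧ : ℝ) : ℂ) := by
  set f : Space → ℂ := fun x => ((ηv⟦a, x⟧ : ℝ) : ℂ) with hf
  set g : Space → ℂ := fun x => cellWave L (-n) x with hg
  have hfd : ∀ x, HasFDerivAt f (Complex.ofRealCLM.comp (fderiv ℝ ηf⟦a⟧ x)) x := fun x =>
    Complex.ofRealCLM.hasFDerivAt.comp x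
      (((contDiff_bump a (n := 1)).differentiable one_ne_zero) x).hasFDerivAt
  have hf' : ∀ x, fderiv ℝ f x (EuclideanSpace.single j 1) =
      (fderiv ℝ ηf⟦a⟧ x (EuclideanSpace.single j 1) : ℂ) := fun x => by
    rw [(hfd x).fderiv]; rfl
  have hg' : ∀ x, fderiv ℝ g x (EuclideanSpace.single j 1) =
      (2 * Real.pi * Complex.I * ((-n) j) / L) * g x := fun x =>
    fderiv_cellWave_apply_single L (-n) x j
  have hfc : Continuous f := Complex.continuous_ofReal.comp (continuous_bump a)
  have hgc : Continuous g := continuous_cellWave L (-n)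
  have hfs : HasCompactSupport f := (hasCompactSupport_bump ha).comp_left Complex.ofReal_zero
  -- integration by parts on `ℝ³`
  have hIBP := integral_mul_fderiv_eq_neg_fderiv_mul_of_integrable (μ := (volume : Measure Space))
    (f := f) (g := g) (v := EuclideanSpace.single j 1) ?_ ?_ ?_
    (fun x _ => (hfd x).differentiableAt) (fun x _ => differentiable_cellWave L (-n) x)
  rotate_left
  · simp only [hf']
    exact ((Complex.continuous_ofReal.comp (continuous_fderiv_bump a _)).mul hgc).integrable_of_hasCompactSupport
      (((hasCompactSupport_fderiv_bump ha _).comp_left Complex.ofReal_zero).mul_right)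
  · simp only [hg']
    exact (hfc.mul (continuous_const.mul hgc)).integrable_of_hasCompactSupport hfs.mul_right
  · exact (hfc.mul hgc).integrable_of_hasCompactSupport hfs.mul_right
  simp only [hf', hg'] at hIBP
  have hlhs : ∫ x, f x * (2 * Real.pi * Complex.I * ((-n) j) / L * g x) =
      -(2 * Real.pi * Complex.I * (n j) / L) * ∫ x, conj (cellWave L n x) * ((ηv⟦a, x⟧ : ℝ) : ℂ) := by
    rw [← integral_const_mul]
    refine integral_congr_ae (Filter.Eventually.of_forall fun x => ?_)
    simp only [hf, hg, conj_cellWave, Pi.neg_apply, Int.cast_neg]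
    ring
  have hrhs : ∫ x, (fderiv ℝ ηf⟦a⟧ x (EuclideanSpace.single j 1) : ℂ) * g x =
      ∫ x, conj (cellWave L n x) * (fderiv ℝ ηf⟦a⟧ x (EuclideanSpace.single j 1) : ℂ) := by
    refine integral_congr_ae (Filter.Eventually.of_forall fun x => ?_)
    simp only [hg, conj_cellWave, mul_comm]
  rw [hlhs, hrhs] at hIBP
  have h2 := congrArg Neg.neg hIBP
  simp only [neg_mul, neg_neg] at h2
  exact h2.symm

end Summit.AtomisticToContinuum.BoseEinsteinCondensation.Theorems.IMUChainGlue

end
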